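import Literature.NumberTheory.NumberFields.UnitRankZeroPowerClasses
import Literature.NumberTheory.QuadraticFields.SqrtNegTwoFieldPrimes
import Literature.NumberTheory.NumberFields.UnramifiedCyclicDegreeDvdClassNumber
import Mathlib.RingTheory.Polynomial.Cyclotomic.Roots
import HarnessLib

/-!
# `K(∅, n) = 1` for `ℚ(√−2)` and odd `n`; no fifth roots of unity; class number one and no real place

PROOF-ONLY file (theorems only, no definition, no named fact, no `sorry`), topic `NumberTheory/NumberFields`;
the `ℚ(√−2)`-twin of the tree's `UnitRankZeroPowerClasses` §3 (`ℚ(ζ₄)`) and `UnitRankZeroPowerClassesThree`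
(`ℚ(ζ₃)`).  Setting: a number field `K` with `[K : ℚ] = 2` and `θ ∈ K`, `θ² = −2` (the tree's standing hypothesis
`SqrtNegTwo.FieldData θ`; `𝓞 K = ℤ[√−2]` via `hK.ringEquiv : ℤ√(-2) ≃+* 𝓞 K`, Euclidean, units `±1`).

* §1 `eq_one_or_eq_neg_one_of_isUnit` — the units of `𝓞 K` are `±1` (`ℤ[√−2]ˣ = {±1}`, tree
  `SqrtNegTwoPrimary.eq_of_isUnit`, transported); **`exists_eq_pow_of_forall_count_dvd_sqrtNegTwo`** — for ODD
  `n`, a nonzero `a ∈ 𝓞 K` all of whose prime exponents are divisible by `n` is an `n`-th power (`𝓞 K` principal,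
  tree `SqrtNegTwoIntegers.isPrincipalIdealRing_ringOfIntegers`; `a = u gⁿ`, `u = ±1 = uⁿ`); field form
  **`exists_eq_pow_of_forall_dvd_log_valuation_sqrtNegTwo`** (`x ∈ Kˣ`, `n ∣ v(x)` for all finite `v` ⟹ `x = yⁿ`).
* §2 `not_isPrimitiveRoot_five_of_finrank_eq_two` — a quadratic field contains no primitive fifth root of unity
  (`[ℚ(ζ₅) : ℚ] = 4 > 2`); `isEmpty_ringHom_real_sqrtNegTwo` (`θ² = −2 < 0`); `classNumber_eq_one_sqrtNegTwo`.

Why (stmt-BirchSwinnertonDyer-22356, «T = FiniteShaComponentTransfer»; BSD is not proved by any of this): these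
are the three global inputs of the `5`-descent on the Kubert–Tate family `E_{m,n} ⊗ ℚ(√−2)` — the kernel
`K(∅, 5) = 1` of the `μ₅`-box, `#E(K)[5] = 5`, and Mazur's étale descent over a field of class number one without
real places —, the third quadratic field (after `ℚ(i)` and `ℚ(ζ₃)`) over which the door at `5` opens on twists
`E_{m,n}^{(−8)}`; `5` is inert in `ℚ(√−2)`, so these twists are NON-anomalous at `5`.

## References

* [SilvermanAEC2009] J. H. Silverman, *The Arithmetic of Elliptic Curves*, 2nd ed., Prop. VIII.1.6, Thm. X.1.1(c).
* [IrelandRosen1990] K. Ireland, M. Rosen, *A Classical Introduction to Modern Number Theory*, 2nd ed., Ch. 1 Ex. 36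
  (`ℤ[√−2]` Euclidean), Ch. 13 §1.
* [Washington1997] L. C. Washington, *Introduction to Cyclotomic Fields*, 2nd ed., Ch. 2 (`[ℚ(ζ_n) : ℚ] = φ(n)`).
-/

noncomputable section

open NumberField IsDedekindDomain Ideal Polynomial

namespace Literature.NumberTheory.NumberFields

open Literature.NumberTheory.QuadraticFields

section SqrtNegTwo

variable {K : Type*} [Field K] [NumberField K] {θ : K}

/-! ## §1 Units and `n`-th power classes of `ℤ[√−2]` -/

/-- **The units of `𝓞 ℚ(√−2) = ℤ[√−2]` are `±1`** (`a² + 2b² = 1` forces `b = 0`; tree `SqrtNegTwoPrimary.eq_of_isUnit`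
on Mathlib's `ℤ√(-2)`, transported along `hK.ringEquiv`). [cite: IrelandRosen1990, Ch. 13 §1] -/
theorem eq_one_or_eq_neg_one_of_isUnit (hK : SqrtNegTwo.FieldData θ) {u : 𝓞 K} (hu : IsUnit u) :
    u = 1 ∨ u = -1 := by
  have hu' : IsUnit (hK.ringEquiv.symm u) := hu.map hK.ringEquiv.symm
  rcases SqrtNegTwoPrimary.eq_of_isUnit hu' with h | h
  · left
    have := congrArg hK.ringEquiv h
    rwa [RingEquiv.apply_symm_apply, map_one] at this
  · right
    have := congrArg hK.ringEquiv h
    rwa [RingEquiv.apply_symm_apply, map_neg, map_one] at this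

/-- **`ℚ(√−2)(∅, n) = 1` for odd `n`**: a nonzero element of `𝓞 K = ℤ[√−2]` all of whose prime exponents are divisible
by the odd number `n` is an `n`-th power in `𝓞 K` (`𝓞 K` principal — tree
`SqrtNegTwoIntegers.isPrincipalIdealRing_ringOfIntegers` —, so `a = u·gⁿ` with a unit `u = ±1 = uⁿ`).
[cite: SilvermanAEC2009, Prop. VIII.1.6] [cite: IrelandRosen1990, Ch. 1 Ex. 36] -/
theorem exists_eq_pow_of_forall_count_dvd_sqrtNegTwo (hK : SqrtNegTwo.FieldData θ) {n : ℕ} (hn : Odd n)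
    {a : 𝓞 K} (ha : a ≠ 0)
    (hdvd : ∀ v : HeightOneSpectrum (𝓞 K),
      n ∣ (Associates.mk v.asIdeal).count (Associates.mk (Ideal.span {a})).factors) :
    ∃ g : 𝓞 K, a = g ^ n := by
  haveI : IsPrincipalIdealRing (𝓞 K) :=
    SqrtNegTwoIntegers.isPrincipalIdealRing_ringOfIntegers hK.finrank_eq hK.sq_eq
  obtain ⟨u, g, h⟩ := exists_unit_mul_pow_of_forall_count_dvd ha hdvd
  rcases eq_one_or_eq_neg_one_of_isUnit hK u.isUnit with hu | hu
  · exact ⟨g, by rw [h, hu, one_mul]⟩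
  · exact ⟨-g, by rw [h, hu, Odd.neg_pow hn, neg_one_mul]⟩

/-- **`ℚ(√−2)(∅, n) = 1`, field form**: a nonzero `x ∈ K = ℚ(√−2)` whose valuation at every finite place is
divisible by the odd number `n` (`n ∣ v(x)` for all `v`) is an `n`-th power in `K` — write `x = a/b` with
`a, b ∈ ℤ[√−2]`, then `a bⁿ⁻¹` has all prime exponents divisible by `n`. [cite: SilvermanAEC2009, Prop. VIII.1.6 and Thm. X.1.1(c)] -/
theorem exists_eq_pow_of_forall_dvd_log_valuation_sqrtNegTwo (hK : SqrtNegTwo.FieldData θ) {n : ℕ} (hn : Odd n)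
    {x : K} (hx : x ≠ 0) (hdvd : ∀ v : HeightOneSpectrum (𝓞 K), (n : ℤ) ∣ WithZero.log (v.valuation K x)) :
    ∃ y : K, x = y ^ n := by
  have hn0 : n ≠ 0 := by rintro rfl; exact Nat.not_odd_zero hn
  obtain ⟨a, b, hb, hab⟩ := IsFractionRing.div_surjective (A := 𝓞 K) x
  have hb0 : (b : 𝓞 K) ≠ 0 := nonZeroDivisors.ne_zero hb
  have hbK : (algebraMap (𝓞 K) K b) ≠ 0 :=
    fun h ↦ hb0 ((FaithfulSMul.algebraMap_injective (𝓞 K) K) (by rw [h, map_zero]))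
  have ha0 : a ≠ 0 := by
    rintro rfl
    rw [map_zero, zero_div] at hab
    exact hx hab.symm
  set c : 𝓞 K := a * b ^ (n - 1) with hc
  have hc0 : c ≠ 0 := mul_ne_zero ha0 (pow_ne_zero _ hb0)
  have hcK : algebraMap (𝓞 K) K c = x * (algebraMap (𝓞 K) K b) ^ n := by
    rw [hc, map_mul, map_pow, ← hab]
    obtain ⟨k, hk⟩ := Nat.exists_eq_succ_of_ne_zero hn0
    rw [hk, Nat.succ_sub_one, pow_succ]
    field_simp
  -- every prime exponent of `c` is divisible by `n`
  have hcdvd : ∀ v : HeightOneSpectrum (𝓞 K),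
      n ∣ (Associates.mk v.asIdeal).count (Associates.mk (Ideal.span {c})).factors := by
    intro v
    have hvx : v.valuation K x ≠ 0 := (Valuation.ne_zero_iff _).mpr hx
    have hvb : v.valuation K (algebraMap (𝓞 K) K b) ≠ 0 := (Valuation.ne_zero_iff _).mpr hbK
    have h1 : WithZero.log (v.valuation K (algebraMap (𝓞 K) K c)) =
        WithZero.log (v.valuation K x) + n • WithZero.log (v.valuation K (algebraMap (𝓞 K) K b)) := by
      rw [hcK, map_mul, map_pow, WithZero.log_mul hvx (pow_ne_zero _ hvb), WithZero.log_pow]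
    have h2 : WithZero.log (v.valuation K (algebraMap (𝓞 K) K c)) =
        -((Associates.mk v.asIdeal).count (Associates.mk (Ideal.span {c})).factors : ℤ) := by
      rw [HeightOneSpectrum.valuation_of_algebraMap, HeightOneSpectrum.intValuation_if_neg _ hc0,
        WithZero.log_exp]
    obtain ⟨k, hk⟩ := hdvd v
    have h3 : ((Associates.mk v.asIdeal).count (Associates.mk (Ideal.span {c})).factors : ℤ) =
        (n : ℤ) * (-k - WithZero.log (v.valuation K (algebraMap (𝓞 K) K b))) := by
      have := h2.symm.trans h1
      rw [hk, nsmul_eq_mul] at this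
      linarith
    have h4 : (n : ℤ) ∣ ((Associates.mk v.asIdeal).count (Associates.mk (Ideal.span {c})).factors : ℤ) :=
      ⟨_, h3⟩
    exact Int.natCast_dvd_natCast.mp h4
  obtain ⟨g, hg⟩ := exists_eq_pow_of_forall_count_dvd_sqrtNegTwo hK hn hc0 hcdvd
  refine ⟨algebraMap (𝓞 K) K g / algebraMap (𝓞 K) K b, ?_⟩
  rw [div_pow, ← map_pow, ← hg, hcK, mul_div_assoc, div_self (pow_ne_zero _ hbK), mul_one]

/-! ## §2 No fifth roots of unity, no real place, class number one -/

omit [NumberField K] in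
/-- **A quadratic number field contains no primitive fifth root of unity**: the minimal polynomial of a
primitive fifth root of unity over `ℚ` is the fifth cyclotomic polynomial, of degree `φ(5) = 4 > 2 = [K : ℚ]`.
[cite: Washington1997, Ch. 2 (degree of ℚ(ζ_n))] -/
theorem not_isPrimitiveRoot_five_of_finrank_eq_two [CharZero K] [FiniteDimensional ℚ K]
    (h2 : Module.finrank ℚ K = 2) (x : K) : ¬ IsPrimitiveRoot x 5 := by
  intro hx
  have hmin : minpoly ℚ x = cyclotomic 5 ℚ := (cyclotomic_eq_minpoly_rat hx (by norm_num)).symm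
  have hdeg : (minpoly ℚ x).natDegree ≤ Module.finrank ℚ K := minpoly.natDegree_le x
  rw [hmin, natDegree_cyclotomic, h2] at hdeg
  have : Nat.totient 5 = 4 := by decide
  omega

/-- `ℚ(√−2)` has no real place: `θ² = −2 < 0`. [cite: IrelandRosen1990, Ch. 13 §1] -/
theorem isEmpty_ringHom_real_sqrtNegTwo (hK : SqrtNegTwo.FieldData θ) : IsEmpty (K →+* ℝ) :=
  isEmpty_ringHom_real_of_sq_eq (q := -2) (δ := θ) (by norm_num) (by rw [hK.sq_eq]; push_cast; ring)

/-- `ℚ(√−2)` has class number one (`𝓞 K = ℤ[√−2]` is Euclidean, hence principal; tree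
`SqrtNegTwoIntegers.isPrincipalIdealRing_ringOfIntegers`). [cite: IrelandRosen1990, Ch. 1 Ex. 36] -/
theorem classNumber_eq_one_sqrtNegTwo (hK : SqrtNegTwo.FieldData θ) : classNumber K = 1 := by
  haveI : IsPrincipalIdealRing (𝓞 K) :=
    SqrtNegTwoIntegers.isPrincipalIdealRing_ringOfIntegers hK.finrank_eq hK.sq_eq
  exact classNumber_eq_one_iff.mpr inferInstance

end SqrtNegTwo

end Literature.NumberTheory.NumberFields

end
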